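import Literature.AlgebraicGeometry.ShimuraVarieties.UnitaryCurveAuxiliaryLevelContainmentV
import Literature.AlgebraicGeometry.ModuliOfAbelianVarieties.SiegelPrincipalLevelNormal
import Literature.AlgebraicGeometry.ModuliOfAbelianVarieties.SiegelPrincipalLevelOpen
import Literature.NumberTheory.Automorphic.Liu2021.AppendixC.HeckeTranslates
import HarnessLib

/-!
# Saturated small levels `K ⊓ b⁻¹K_δ(N)`: a small level below `K`, NORMAL in `K`; for a frame family on ONE lattice, ONE level for every frame

Topic `AlgebraicGeometry/ShimuraVarieties`; namespaces `Literature.AlgebraicGeometry.ShimuraVarieties.SaturatedLevel` (§1–§2, any topological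
group `G` with a homomorphism `b : G →* GSp_δ(𝔸_{ℚ,f})`) and `Literature.AlgebraicGeometry.ShimuraVarieties.UnitaryCurve.AuxV` (§3, the auxiliary
frames `ũ_{Fr} ∘ inl` of ★ E1).  Theorems only (no definition, no named fact, no instance).  Cell `hodgecm-mathlib` (D-0151), FLOOR 0, P6 «MOD
programme», door (E): organ «COMMON SMALL LEVEL OF A FRAME FAMILY» of the X-leaf socket `stub_EFRAMES` ∕ head `eLaws_of_frames`
(`Cruxes/HLiu418/Lines/F0_P6a_EExports.lean`), `--supports stmt-HodgeConjecture-24832`, count-neutral; HC_CM is proved only modulo the printed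
citations until rung 0 closes.

THE POINT.  [Deligne1971TravauxShimura] Prop. 1.15 p. 132 («pour `K₁` assez petit … `K₂ ⊃ u(K₁)`») and Exemple 4.16 p. 150 (the principal congruence
subgroup `K(N)` of a lattice); [Milne2005ShimuraVarieties] §6 p. 70 (`K(N)` is normal in `GSp(ℤ̂)`), §13 p. 118 (the level condition `g⁻¹Kg ⊆ K′`):
given a level `K` read in `GSp_δ(ℤ̂) = K_δ(1)` through a homomorphism `b` (`b(K) ⊆ K_δ(1)`), the SATURATED sublevel `K ⊓ b⁻¹K_δ(N)` is open and compact
(for `b` continuous, `N ≠ 0`), lies below `K`, and is NORMALISED BY `K` — because `K_δ(N) ⊴ K_δ(1)` (★ `principalLevelSubgroup_normal_in_one`).  For a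
FAMILY of symplectic frames `Frᵢ` cut on ONE lattice (★ 7b-FAMILY `exists_symplecticFrameV_family_integralAction`: `auxLevelV (Fr i) m = auxLevelV (Fr i′) m`),
the saturated level `K ⊓ inl⁻¹K̃_{Frᵢ}(N)` is THE SAME for every `i`: one small level `Kc ≤ K`, normal in `K`, with `Kc = K ⊓ bᵢ⁻¹K_{δᵢ}(N)` for ALL `i`
([RapoportSmithlingZhang2020Diagonal] Remark 3.2 (ii)(iii) pp. 9–10, §4.1 p. 17: one `𝒪`-lattice, several auxiliary data).

* §1 `le_of_carrier_eq_inf_comap`, **`heckeLE_of_carrier_eq_inf_comap`** (normality `C5.HeckeLE u Kc Kc` for `u ∈ K`), `heckeLE_of_carrier_eq_inf_comap_of_mem`.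
* §2 `isOpen_inf_comap`, `isCompact_inf_comap`, `exists_smallLevel_carrier_eq_inf_comap`, **`exists_smallLevel_saturated`** (one `b`).
* §3 `comap_inl_auxLevelV`, `comap_comp_inl_eq_of_auxLevelV_eq`, **`exists_smallLevel_saturated_family`** (HEAD; any index type, empty allowed),
  `exists_smallLevel_saturated_family_of_prod_le` (hypothesis in the `K × L₀ ≤ K̃_{Frᵢ}(1)` currency of ★ 7b-FAMILY).

## References
* [Deligne1971TravauxShimura] P. Deligne, *Travaux de Shimura*, Sém. Bourbaki 389 (1971), Prop. 1.15 p. 132, Exemple 4.16 p. 150.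
* [Milne2005ShimuraVarieties] J. S. Milne, *Introduction to Shimura varieties* (2005), §6 p. 70, §13 p. 118.
* [RapoportSmithlingZhang2020Diagonal] M. Rapoport, B. Smithling, W. Zhang, Compos. Math. 156 (2020), Remark 3.2 (ii)(iii) pp. 9–10, §4.1 p. 17.
-/

set_option autoImplicit false

noncomputable section

open NumberField
open Literature.AlgebraicGeometry.ModuliOfAbelianVarieties
open Literature.NumberTheory.Automorphic.Liu2021.AppendixC

namespace Literature.AlgebraicGeometry.ShimuraVarieties

/-! ### §1. Below `K` and normal in `K` -/

namespace SaturatedLevel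

variable {G : Type} [Group G] [TopologicalSpace G] {K₀ : C5.OpenCompactSubgroup G} {g : ℕ} {δ : Fin g → ℕ}

/-- A small level whose underlying subgroup is `K ⊓ b⁻¹K_δ(N)` lies below `K` (the index order of the levels).
[cite: Milne2005ShimuraVarieties, §13 p. 118] -/
theorem le_of_carrier_eq_inf_comap (K Kc : C5.SmallLevel K₀) (b : G →* ↥(gspFinAdelic δ)) (N : ℕ)
    (hKc : Kc.1.1 = K.1.1 ⊓ (principalLevelSubgroup δ N).comap b) : Kc ≤ K := by
  change Kc.1.1 ≤ K.1.1
  rw [hKc]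
  exact inf_le_left

/-- **`K ⊓ b⁻¹K_δ(N)` IS NORMALISED BY `K`** when `b(K) ⊆ K_δ(1)`: for `u ∈ K` and `x ∈ K ⊓ b⁻¹K_δ(N)`, `u⁻¹xu ∈ K ⊓ b⁻¹K_δ(N)` — the level
condition `C5.HeckeLE u Kc Kc` of [Milne2005ShimuraVarieties] §13 — since `b(u) ∈ K_δ(1)` normalises `K_δ(N)` (★ `principalLevelSubgroup_normal_in_one`).
[cite: Milne2005ShimuraVarieties, §6 p. 70 and §13 p. 118] [cite: Deligne1971TravauxShimura, Exemple 4.16 p. 150] -/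
theorem heckeLE_of_carrier_eq_inf_comap (K Kc : C5.SmallLevel K₀) (b : G →* ↥(gspFinAdelic δ)) (N : ℕ)
    (hb1 : K.1.1 ≤ (principalLevelSubgroup δ 1).comap b) (hKc : Kc.1.1 = K.1.1 ⊓ (principalLevelSubgroup δ N).comap b)
    {u : G} (hu : u ∈ K.1.1) : C5.HeckeLE u Kc Kc := by
  intro x hx
  rw [hKc] at hx ⊢
  refine ⟨Subgroup.mul_mem _ (Subgroup.mul_mem _ (Subgroup.inv_mem _ hu) hx.1) hu, ?_⟩
  have h := principalLevelSubgroup_normal_in_one δ N (Subgroup.inv_mem _ (hb1 hu)) hx.2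
  rw [inv_inv] at h
  change b (u⁻¹ * x * u) ∈ principalLevelSubgroup δ N
  rw [map_mul, map_mul, map_inv]
  exact h

/-- The saturated level is in particular normal in ITSELF through `K` (`u ∈ Kc ⊆ K`). [cite: Milne2005ShimuraVarieties, §13 p. 118] -/
theorem heckeLE_of_carrier_eq_inf_comap_of_mem (K Kc : C5.SmallLevel K₀) (b : G →* ↥(gspFinAdelic δ)) (N : ℕ)
    (hb1 : K.1.1 ≤ (principalLevelSubgroup δ 1).comap b) (hKc : Kc.1.1 = K.1.1 ⊓ (principalLevelSubgroup δ N).comap b)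
    {u : G} (hu : u ∈ Kc.1.1) : C5.HeckeLE u Kc Kc :=
  heckeLE_of_carrier_eq_inf_comap K Kc b N hb1 hKc ((le_of_carrier_eq_inf_comap K Kc b N hKc : Kc.1.1 ≤ K.1.1) hu)

/-- The saturated level is mapped by `b` into `K_δ(N)`. [cite: Deligne1971TravauxShimura, Prop. 1.15 p. 132] -/
theorem carrier_le_comap_of_carrier_eq_inf_comap (K Kc : C5.SmallLevel K₀) (b : G →* ↥(gspFinAdelic δ)) (N : ℕ)
    (hKc : Kc.1.1 = K.1.1 ⊓ (principalLevelSubgroup δ N).comap b) : Kc.1.1 ≤ (principalLevelSubgroup δ N).comap b := by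
  rw [hKc]
  exact inf_le_right

/-! ### §2. Open, compact: the saturated sublevel is a small level -/

/-- `K ⊓ b⁻¹K_δ(N)` is OPEN for `K` open, `b` continuous and `N ≠ 0` (★ `isOpen_principalLevelSubgroup`). [cite: Deligne1971TravauxShimura, Prop. 1.15 p. 132] -/
theorem isOpen_inf_comap (b : G →* ↥(gspFinAdelic δ)) (hbcont : Continuous b) {N : ℕ} (hN : N ≠ 0) (K : Subgroup G)
    (hK : IsOpen (K : Set G)) : IsOpen ((K ⊓ (principalLevelSubgroup δ N).comap b : Subgroup G) : Set G) := by
  rw [Subgroup.coe_inf, Subgroup.coe_comap]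
  exact hK.inter ((isOpen_principalLevelSubgroup δ hN).preimage hbcont)

/-- `K ⊓ b⁻¹K_δ(N)` is COMPACT for `K` compact, `b` continuous and `N ≠ 0` (★ `isClosed_principalLevelSubgroup`). [cite: Deligne1971TravauxShimura, Prop. 1.15 p. 132] -/
theorem isCompact_inf_comap (b : G →* ↥(gspFinAdelic δ)) (hbcont : Continuous b) {N : ℕ} (hN : N ≠ 0) (K : Subgroup G)
    (hK : IsCompact (K : Set G)) : IsCompact ((K ⊓ (principalLevelSubgroup δ N).comap b : Subgroup G) : Set G) := by
  rw [Subgroup.coe_inf, Subgroup.coe_comap]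
  exact hK.inter_right ((isClosed_principalLevelSubgroup δ hN).preimage hbcont)

/-- The saturated sublevel `K ⊓ b⁻¹K_δ(N)` of a small level `K ≤ K₀` IS a small level (open, compact, below `K₀`).
[cite: Deligne1971TravauxShimura, Prop. 1.15 p. 132] -/
theorem exists_smallLevel_carrier_eq_inf_comap (K : C5.SmallLevel K₀) (b : G →* ↥(gspFinAdelic δ)) (hbcont : Continuous b) {N : ℕ}
    (hN : N ≠ 0) : ∃ Kc : C5.SmallLevel K₀, Kc.1.1 = K.1.1 ⊓ (principalLevelSubgroup δ N).comap b :=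
  ⟨⟨⟨K.1.1 ⊓ (principalLevelSubgroup δ N).comap b, isOpen_inf_comap b hbcont hN K.1.1 K.1.2.1, isCompact_inf_comap b hbcont hN K.1.1 K.1.2.2⟩,
      le_trans (inf_le_left : K.1.1 ⊓ (principalLevelSubgroup δ N).comap b ≤ K.1.1) K.2⟩, rfl⟩

/-- **THE SATURATED SMALL LEVEL** (one Hodge-embedding `b`): for a small level `K ≤ K₀`, a continuous `b : G → GSp_δ(𝔸_f)` with `b(K) ⊆ K_δ(1)` and
`N ≠ 0`, there is a small level `Kc ≤ K`, NORMAL in `K` (`C5.HeckeLE u Kc Kc` for all `u ∈ K`), with `Kc = K ⊓ b⁻¹K_δ(N)`.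
[cite: Deligne1971TravauxShimura, Prop. 1.15 p. 132 and Exemple 4.16 p. 150] [cite: Milne2005ShimuraVarieties, §6 p. 70 and §13 p. 118] -/
theorem exists_smallLevel_saturated (K : C5.SmallLevel K₀) (b : G →* ↥(gspFinAdelic δ)) (hbcont : Continuous b)
    (hb1 : K.1.1 ≤ (principalLevelSubgroup δ 1).comap b) {N : ℕ} (hN : N ≠ 0) :
    ∃ Kc : C5.SmallLevel K₀, Kc ≤ K ∧ (∀ u ∈ K.1.1, C5.HeckeLE u Kc Kc) ∧ Kc.1.1 = K.1.1 ⊓ (principalLevelSubgroup δ N).comap b := by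
  obtain ⟨Kc, hKc⟩ := exists_smallLevel_carrier_eq_inf_comap K b hbcont hN
  exact ⟨Kc, le_of_carrier_eq_inf_comap K Kc b N hKc, fun u hu => heckeLE_of_carrier_eq_inf_comap K Kc b N hb1 hKc hu, hKc⟩

end SaturatedLevel

/-! ### §3. A frame family on ONE lattice: one saturated level for every frame -/

namespace UnitaryCurve

namespace AuxV

open Literature.AlgebraicGeometry.ShimuraVarieties.UnitaryCanonicalModel.Aux (torusFinAdelic)
open Literature.NumberTheory.Automorphic Literature.NumberTheory.Automorphic.UnitaryGroup

variable {L : Type} [Field L] [NumberField L] [IsCMField L] {M : Type} [Field M] [NumberField M] [IsCMField M]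
  {j : L →+* M} {n : ℕ} {H : Matrix (Fin n) (Fin n) L}

/-- The `inl`-pull-back of the auxiliary level is the principal level pulled back along the Hodge-embedding `b = ũ_{Fr} ∘ inl`:
`inl⁻¹K̃_{Fr}(m) = (ũ_{Fr} ∘ inl)⁻¹K_δ(m)`. [cite: Deligne1971TravauxShimura, Prop. 1.15 p. 132] -/
theorem comap_inl_auxLevelV {ξ : M} {g : ℕ} {δ : Fin g → ℕ} (Fr : SymplecticFrameV M j H ξ g δ) (m : ℕ) :
    (auxLevelV Fr m).comap (MonoidHom.inl _ ↥(torusFinAdelic M)) =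
      (principalLevelSubgroup δ m).comap ((auxToGspFinV Fr).comp (MonoidHom.inl _ ↥(torusFinAdelic M))) := by
  rw [auxLevelV, Subgroup.comap_comap]

/-- **Two frames on one lattice have the same saturating level**: `K̃_{Fr}(m) = K̃_{Fr′}(m)` gives `b_{Fr}⁻¹K_δ(m) = b_{Fr′}⁻¹K_{δ′}(m)`.
[cite: Deligne1971TravauxShimura, Exemple 4.16 p. 150] [cite: RapoportSmithlingZhang2020Diagonal, Remark 3.2 (ii)(iii) pp. 9–10] -/
theorem comap_comp_inl_eq_of_auxLevelV_eq {ξ ξ' : M} {g g' : ℕ} {δ : Fin g → ℕ} {δ' : Fin g' → ℕ}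
    (Fr : SymplecticFrameV M j H ξ g δ) (Fr' : SymplecticFrameV M j H ξ' g' δ') {m : ℕ} (h : auxLevelV Fr m = auxLevelV Fr' m) :
    (principalLevelSubgroup δ m).comap ((auxToGspFinV Fr).comp (MonoidHom.inl _ ↥(torusFinAdelic M))) =
      (principalLevelSubgroup δ' m).comap ((auxToGspFinV Fr').comp (MonoidHom.inl _ ↥(torusFinAdelic M))) := by
  rw [← comap_inl_auxLevelV, ← comap_inl_auxLevelV, h]

/-- **HEAD — ONE SATURATED SMALL LEVEL FOR A WHOLE FRAME FAMILY.**  For a small level `K ≤ K₀` of `U(H)(𝔸_f)`, a family of symplectic frames `Frᵢ`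
(any index type, possibly empty) with `K ⊆ inl⁻¹K̃_{Frᵢ}(1)` (i.e. `bᵢ(K) ⊆ K_{δᵢ}(1)`, the integrality conjunct of ★ 7b) and the COMMON-LATTICE law
`K̃_{Frᵢ}(m) = K̃_{Frᵢ′}(m)` (★ 7b-FAMILY), and `N ≠ 0`: there is ONE small level `Kc ≤ K`, NORMAL in `K` (`C5.HeckeLE u Kc Kc` for `u ∈ K`), such that
`Kc = K ⊓ bᵢ⁻¹K_{δᵢ}(N)` for EVERY `i` (`bᵢ = ũ_{Frᵢ} ∘ inl`) — so each frame՚s single-frame construction at «its» saturated level runs at the common `Kc`.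
[cite: Deligne1971TravauxShimura, Prop. 1.15 p. 132 and Exemple 4.16 p. 150] [cite: RapoportSmithlingZhang2020Diagonal, Remark 3.2 (ii)(iii) pp. 9–10 and §4.1 p. 17]
[cite: Milne2005ShimuraVarieties, §6 p. 70 and §13 p. 118] -/
theorem exists_smallLevel_saturated_family
    {K₀ : C5.OpenCompactSubgroup ↥(finAdelic (↥(maximalRealSubfield L)) L (IsCMField.complexConj L) n H)} (K : C5.SmallLevel K₀)
    {ι : Type} {ξ : ι → M} {g : ι → ℕ} {δ : (i : ι) → Fin (g i) → ℕ} (Fr : (i : ι) → SymplecticFrameV M j H (ξ i) (g i) (δ i))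
    (hK1 : ∀ i, K.1.1 ≤ (auxLevelV (Fr i) 1).comap (MonoidHom.inl _ ↥(torusFinAdelic M)))
    (hcommon : ∀ (m : ℕ) (i i' : ι), auxLevelV (Fr i) m = auxLevelV (Fr i') m) {N : ℕ} (hN : N ≠ 0) :
    ∃ Kc : C5.SmallLevel K₀, Kc ≤ K ∧ (∀ u ∈ K.1.1, C5.HeckeLE u Kc Kc) ∧
      ∀ i, Kc.1.1 = K.1.1 ⊓ (principalLevelSubgroup (δ i) N).comap ((auxToGspFinV (Fr i)).comp (MonoidHom.inl _ ↥(torusFinAdelic M))) := by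
  rcases isEmpty_or_nonempty ι with hι | ⟨⟨i₀⟩⟩
  · -- no frame: `K` itself (normal in itself)
    exact ⟨K, le_rfl, fun u hu x hx => Subgroup.mul_mem _ (Subgroup.mul_mem _ (Subgroup.inv_mem _ hu) hx) hu, fun i => (IsEmpty.false i).elim⟩
  · -- the saturated level of ONE frame `i₀` …
    let Kc : C5.SmallLevel K₀ :=
      ⟨⟨K.1.1 ⊓ (auxLevelV (Fr i₀) N).comap (MonoidHom.inl _ ↥(torusFinAdelic M)),
          isOpen_inf_comap_inl_auxLevelV (Fr i₀) hN K.1.1 K.1.2.1, isCompact_inf_comap_inl_auxLevelV (Fr i₀) hN K.1.1 K.1.2.2⟩,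
        le_trans (inf_comap_inl_auxLevelV_le (Fr i₀) N K.1.1).1 K.2⟩
    -- … is the saturated level of EVERY frame (common lattice)
    have hKc : ∀ i, Kc.1.1 = K.1.1 ⊓ (principalLevelSubgroup (δ i) N).comap ((auxToGspFinV (Fr i)).comp (MonoidHom.inl _ ↥(torusFinAdelic M))) :=
      fun i => by
        change K.1.1 ⊓ (auxLevelV (Fr i₀) N).comap (MonoidHom.inl _ ↥(torusFinAdelic M)) = _
        rw [hcommon N i₀ i, comap_inl_auxLevelV]
    have hb1 : K.1.1 ≤ (principalLevelSubgroup (δ i₀) 1).comap ((auxToGspFinV (Fr i₀)).comp (MonoidHom.inl _ ↥(torusFinAdelic M))) := by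
      rw [← comap_inl_auxLevelV]
      exact hK1 i₀
    exact ⟨Kc, SaturatedLevel.le_of_carrier_eq_inf_comap K Kc _ N (hKc i₀),
      fun u hu => SaturatedLevel.heckeLE_of_carrier_eq_inf_comap K Kc _ N hb1 (hKc i₀) hu, hKc⟩

/-- The head in the currency of ★ 7b-FAMILY `exists_symplecticFrameV_family_integralAction` (`K × L₀ ≤ K̃_{Frᵢ}(1)` for some compact `L₀`, e.g. `⊥`):
one small level `Kc ≤ K`, normal in `K`, saturated for EVERY frame of the family.
[cite: Deligne1971TravauxShimura, Prop. 1.15 p. 132] [cite: RapoportSmithlingZhang2020Diagonal, Remark 3.2 (ii)(iii) pp. 9–10 and §4.1 p. 17] -/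
theorem exists_smallLevel_saturated_family_of_prod_le
    {K₀ : C5.OpenCompactSubgroup ↥(finAdelic (↥(maximalRealSubfield L)) L (IsCMField.complexConj L) n H)} (K : C5.SmallLevel K₀)
    {ι : Type} {ξ : ι → M} {g : ι → ℕ} {δ : (i : ι) → Fin (g i) → ℕ} (Fr : (i : ι) → SymplecticFrameV M j H (ξ i) (g i) (δ i))
    (L₀ : Subgroup ↥(torusFinAdelic M)) (hK1 : ∀ i, K.1.1.prod L₀ ≤ auxLevelV (Fr i) 1)
    (hcommon : ∀ (m : ℕ) (i i' : ι), auxLevelV (Fr i) m = auxLevelV (Fr i') m) {N : ℕ} (hN : N ≠ 0) :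
    ∃ Kc : C5.SmallLevel K₀, Kc ≤ K ∧ (∀ u ∈ K.1.1, C5.HeckeLE u Kc Kc) ∧
      ∀ i, Kc.1.1 = K.1.1 ⊓ (principalLevelSubgroup (δ i) N).comap ((auxToGspFinV (Fr i)).comp (MonoidHom.inl _ ↥(torusFinAdelic M))) :=
  exists_smallLevel_saturated_family K Fr
    (fun i a ha => by
      rw [Subgroup.mem_comap, MonoidHom.inl_apply]
      exact hK1 i (Subgroup.mem_prod.mpr ⟨ha, Subgroup.one_mem _⟩))
    hcommon hN

end AuxV

end UnitaryCurve

end Literature.AlgebraicGeometry.ShimuraVarieties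

end
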